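import Summits.CriticalPhenomena.SAWScalingLimit.Theses.SAWSpinMonotone
import Summits.CriticalPhenomena.SAWScalingLimit.Theses.SAWDevelopingMap
import HarnessLib

/-!
# Strategist b1 sketch — crux stmt-CriticalPhenomena-10472 `ObservableToSLE`
(route `SAWSpinMonotone`; shared verbatim with `SAWDevelopingMap`)

Signatures cited in `Cruxes/ObservableToSLE/STRATEGY-CENSUS.md`, § "Addendum (seat b1)".
Nothing here is a line or a stub; these are the typed objects of the census attempts.
-/

noncomputable section

open scoped Topology BigOperators
open Filter Set MeasureTheory Metric
open Literature.Probability.LatticeModels (HexVertex hexGraph hexCenter)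
open Literature.Probability.RandomPlanarGeometry
open Literature.Probability.RandomPlanarGeometry.SAW

namespace Summit.CriticalPhenomena.SAWScalingLimit.Cruxes.ObservableToSLE.StrategistB1

/-! ## §0 The two wanting routes' copies of the crux are ONE statement (definitional unfolding). -/

theorem spinMonotone_iff_developingMap :
    Theses.SAWSpinMonotone.ObservableToSLE ↔ Theses.SAWDevelopingMap.ObservableToSLE := Iff.rfl

theorem hexObservableLimit_iff :
    Theses.SAWSpinMonotone.HexObservableLimit ↔ Theses.SAWDevelopingMap.HexObservableLimit := Iff.rfl

theorem hexTight_iff : Theses.SAWSpinMonotone.HexTight ↔ Theses.SAWDevelopingMap.HexTight := Iff.rfl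

/-! ## §T Transfer, route-internal: what the routes' all-domain no-fold bound (K) gives at lattice
scale (provable now), and the statement at which the quasiconformal-stability transfer stops. -/

/-- **(K) ⇒ micro-comparability of the three port moduli at every vertex** (provable now, size S;
the first lemma of the transfer attempt — the place where the argument does NOT break).  Writing the
three port values at `v` as `F_i = A + B ω^{∓i}` (DCS Lemma 1 kills one `ℤ/3`-mode), `NoFoldBound` is
`‖B‖ ≤ k‖A‖`, whence `(1-k)‖A‖ ≤ ‖F_i‖ ≤ (1+k)‖A‖` and the port moduli are pairwise comparable with
`C = (1+k)/(1-k)`; at boundary mid-edges the modulus is the critical arch mass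
(`TwoPiece.norm_observable_eq_archMass`), so exit masses are comparable along chains of vertices,
with constants exponential in the LATTICE length of the chain — and only there. -/
def MicroComparability : Prop :=
  Theses.SAWDevelopingMap.NoFoldBound →
    ∃ C : ℝ, 0 < C ∧ ∀ (Λ : Finset HexVertex), hexDomainSimplyConnected Λ →
      ∀ a ∈ hexDomainBoundary Λ, ∀ v ∈ Λ, ∀ w w' : HexVertex,
        hexGraph.Adj v w → hexGraph.Adj v w' →
          ‖hexParafermionicObservable Λ a hexCriticalFugacity (5 / 8) s(v, w)‖ ≤
            C * ‖hexParafermionicObservable Λ a hexCriticalFugacity (5 / 8) s(v, w')‖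

/-- **MESOSCOPIC SOURCE LOCALITY** — the input the quasiconformal-stability transfer needs in order to
normalise the comparison map `H_Λ ∘ H_{Λ ∩ B(a,r)}⁻¹` at the developed image of the source: chords of
the admissible family from `a δ` to boundary mid-edges at LATTICE distance `≤ k` do not reach
MACROSCOPIC distance `r`, uniformly along `δ → 0⁺` (for each fixed `k`).  Same species as the live
`stub_macroSourceLocality` (targets at macroscopic distance `t → 0`), one scale down; in FLOOR domains
(the whole `Λ δ` above the row of `a δ`) it follows from the half-plane arch identity
`c_α A(x_c) = 1`, in general admissible families it is open for the same reason the anchor is. -/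
def MesoSourceLocality : Prop :=
  ∀ (E : DobrushinDomain) (ρ : ℝ) (Λ : ℝ → Finset HexVertex) (m₀ : ℝ → ℤ) (a : ℝ → Sym2 HexVertex),
    0 < ρ → E.carrier ∩ ball (E.pt 0) ρ = {z : ℂ | (E.pt 0).im < z.im} ∩ ball (E.pt 0) ρ →
    (∀ᶠ δ : ℝ in 𝓝[>] 0, hexDomainSimplyConnected (Λ δ) ∧ a δ ∈ hexDomainBoundary (Λ δ) ∧
      (∀ v ∈ Λ δ, (δ : ℂ) * hexCenter v ∈ E.carrier) ∧
      (∀ v : HexVertex, (δ : ℂ) * hexCenter v ∈ ball (E.pt 0) ρ → (v ∈ Λ δ ↔ m₀ δ ≤ v.1 1))) →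
    Tendsto (fun δ : ℝ => (δ : ℂ) * hexMidpoint (a δ)) (𝓝[>] 0) (𝓝 (E.pt 0)) →
    ∀ ε : ℝ, 0 < ε → ∀ r : ℝ, 0 < r → ∀ (z : ℝ → Sym2 HexVertex) (k : ℕ),
      (∀ᶠ δ : ℝ in 𝓝[>] 0, z δ ∈ hexDomainBoundary (Λ δ) ∧
        dist (hexMidpoint (z δ)) (hexMidpoint (a δ)) ≤ k) →
      ∀ᶠ δ : ℝ in 𝓝[>] 0,
        (∑ γ : HexMidEdgeSAW (Λ δ) (a δ) (z δ),
            if ∃ v ∈ γ.verts, r ≤ dist ((δ : ℂ) * hexCenter v) ((δ : ℂ) * hexMidpoint (a δ))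
            then hexCriticalFugacity ^ γ.length else 0) ≤
          ε * ∑ γ : HexMidEdgeSAW (Λ δ) (a δ) (z δ), hexCriticalFugacity ^ γ.length

/-- The shape of the route-internal transfer as it would have to be registered (NOT registered: its
research input `MesoSourceLocality` is the anchor species again, and the rough TARGET still needs the
live line's renewal at `b`).  `(K)`, `(M)` are the sibling route's items verbatim. -/
def QCStabilityTransferShape : Prop :=
  Theses.SAWDevelopingMap.NoFoldBound → Theses.SAWDevelopingMap.InteriorFlattening →
    MesoSourceLocality →
    -- the live line's weakened anchor, conclusion form (targets `s_t`, `t → 0`):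
    ∀ (E : DobrushinDomain) (ρ : ℝ) (Λ : ℝ → Finset HexVertex) (m₀ : ℝ → ℤ)
      (a : ℝ → Sym2 HexVertex),
      0 < ρ → E.carrier ∩ ball (E.pt 0) ρ = {z : ℂ | (E.pt 0).im < z.im} ∩ ball (E.pt 0) ρ →
      (∀ᶠ δ : ℝ in 𝓝[>] 0, hexDomainSimplyConnected (Λ δ) ∧
        (hexGraph.induce (↑(Λ δ) : Set HexVertex)).Preconnected ∧ a δ ∈ hexDomainBoundary (Λ δ) ∧
        (∀ v ∈ Λ δ, (δ : ℂ) * hexCenter v ∈ E.carrier) ∧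
        (∀ v : HexVertex, (δ : ℂ) * hexCenter v ∈ ball (E.pt 0) ρ → (v ∈ Λ δ ↔ m₀ δ ≤ v.1 1))) →
      (∀ K : Set ℂ, IsCompact K → K ⊆ E.carrier →
        ∀ᶠ δ : ℝ in 𝓝[>] 0, ∀ v : HexVertex, (δ : ℂ) * hexCenter v ∈ K → v ∈ Λ δ) →
      Tendsto (fun δ : ℝ => (δ : ℂ) * hexMidpoint (a δ)) (𝓝[>] 0) (𝓝 (E.pt 0)) →
      ∀ ε : ℝ, 0 < ε → ∀ r : ℝ, 0 < r → ∃ t₀ : ℝ, 0 < t₀ ∧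
        ∀ (s : ℝ → Sym2 HexVertex) (t : ℝ), t ≠ 0 → |t| < t₀ →
          (∀ᶠ δ : ℝ in 𝓝[>] 0, s δ ∈ hexDomainBoundary (Λ δ) ∧
            (hexMidpoint (s δ)).im = (hexMidpoint (a δ)).im) →
          Tendsto (fun δ : ℝ => (δ : ℂ) * hexMidpoint (s δ)) (𝓝[>] 0) (𝓝 (E.pt 0 + t)) →
          ∀ᶠ δ : ℝ in 𝓝[>] 0,
            (∑ γ : HexMidEdgeSAW (Λ δ) (a δ) (s δ),
                if ∃ v ∈ γ.verts, r ≤ dist ((δ : ℂ) * hexCenter v) ((δ : ℂ) * hexMidpoint (a δ))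
                then hexCriticalFugacity ^ γ.length else 0) ≤
              ε * ∑ γ : HexMidEdgeSAW (Λ δ) (a δ) (s δ), hexCriticalFugacity ^ γ.length

/-! ## §S Strengthen: the SOURCE-FREE observable limit (pin only the normalisation point `pt 1`).
It implies the crux's hypothesis (checked below), would make the rough SOURCE of the slit-domain
martingale harmless (the source factor cancels in `⟨ψ,F⟩/F(b)`), and buys nothing for THIS step
because the conclusion's TARGET `b` is rough as well (`IsEmbEndpointApprox` at both marks). -/

/-- DCS Conjecture 2, ψ-averaged and `b`-normalised, pinned conformally ONLY at `pt 1`. -/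
def SourceFreeObservableLimit : Prop :=
  ∃ c : ℂ, c ≠ 0 ∧ ∀ (D : DobrushinDomain) (ρ : ℝ) (Λ : ℝ → Finset HexVertex) (m₁ : ℝ → ℤ)
    (a b : ℝ → Sym2 HexVertex) (Φ : ConformalEquiv D.carrier UpperHalfPlane.upperHalfPlaneSet)
    (L : ℂ → ℂ) (Lb : ℂ) (ψ : ℂ → ℂ),
    let F : ℝ → Sym2 HexVertex → ℂ := fun δ z =>
      hexParafermionicObservable (Λ δ) (a δ) hexCriticalFugacity (5 / 8) z
    0 < ρ →
    D.carrier ∩ Metric.ball (D.pt 1) ρ = {z : ℂ | (D.pt 1).im < z.im} ∩ Metric.ball (D.pt 1) ρ →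
    (∀ᶠ δ : ℝ in nhdsWithin 0 (Set.Ioi 0), hexDomainSimplyConnected (Λ δ) ∧
      a δ ∈ hexDomainBoundary (Λ δ) ∧ b δ ∈ hexDomainBoundary (Λ δ) ∧
      Nonempty (HexMidEdgeSAW (Λ δ) (a δ) (b δ)) ∧
      (hexGraph.induce ((Λ δ : Finset HexVertex) : Set HexVertex)).Preconnected ∧
      (∀ v ∈ Λ δ, (δ : ℂ) * hexCenter v ∈ D.carrier) ∧
      (∀ v : HexVertex, (δ : ℂ) * hexCenter v ∈ Metric.ball (D.pt 1) ρ →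
        (v ∈ Λ δ ↔ m₁ δ ≤ v.1 1))) →
    (∀ K : Set ℂ, IsCompact K → K ⊆ D.carrier → ∀ᶠ δ : ℝ in nhdsWithin 0 (Set.Ioi 0),
      ∀ v : HexVertex, (δ : ℂ) * hexCenter v ∈ K → v ∈ Λ δ) →
    Filter.Tendsto (fun δ : ℝ => (δ : ℂ) * hexMidpoint (a δ)) (nhdsWithin 0 (Set.Ioi 0))
      (nhds (D.pt 0)) →
    Filter.Tendsto (fun δ : ℝ => (δ : ℂ) * hexMidpoint (b δ)) (nhdsWithin 0 (Set.Ioi 0))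
      (nhds (D.pt 1)) →
    Filter.Tendsto (fun x => ‖Φ x‖) (nhdsWithin (D.pt 0) D.carrier) Filter.atTop →
    Φ.HasBoundaryValue (D.pt 1) 0 → ContinuousOn L D.carrier →
    (∀ z ∈ D.carrier, Complex.exp (L z) = deriv Φ z) →
    Filter.Tendsto L (nhdsWithin (D.pt 1) D.carrier) (nhds Lb) →
    Continuous ψ → HasCompactSupport ψ → tsupport ψ ⊆ D.carrier →
    Filter.Tendsto (fun δ : ℝ => (δ : ℂ) ^ 2 *
        (∑ᶠ e ∈ hexDomainMidEdges (Λ δ), ψ ((δ : ℂ) * hexMidpoint e) * F δ e) / F δ (b δ))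
      (nhdsWithin 0 (Set.Ioi 0))
      (nhds (c * ∫ z, ψ z * Complex.exp ((5 / 8 : ℂ) * (L z - Lb))))

/-- `SourceFreeObservableLimit` strengthens the crux's first hypothesis (both route copies). -/
theorem hexObservableLimit_of_sourceFree (h : SourceFreeObservableLimit) :
    Theses.SAWSpinMonotone.HexObservableLimit := by
  obtain ⟨c, hc, h⟩ := h
  refine ⟨c, hc, ?_⟩
  intro D ρ Λ m a b Φ L Lb ψ F hρ hflat hadm hK ha hb hΦa hΦb hL hexpL hLb hψ hψc hψs
  have hadm' : ∀ᶠ δ : ℝ in nhdsWithin 0 (Set.Ioi 0), hexDomainSimplyConnected (Λ δ) ∧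
      a δ ∈ hexDomainBoundary (Λ δ) ∧ b δ ∈ hexDomainBoundary (Λ δ) ∧
      Nonempty (HexMidEdgeSAW (Λ δ) (a δ) (b δ)) ∧
      (hexGraph.induce ((Λ δ : Finset HexVertex) : Set HexVertex)).Preconnected ∧
      (∀ v ∈ Λ δ, (δ : ℂ) * hexCenter v ∈ D.carrier) ∧
      (∀ v : HexVertex, (δ : ℂ) * hexCenter v ∈ Metric.ball (D.pt 1) ρ →
        (v ∈ Λ δ ↔ m 1 δ ≤ v.1 1)) :=
    hadm.mono fun δ hδ => ⟨hδ.1, hδ.2.1, hδ.2.2.1, hδ.2.2.2.1, hδ.2.2.2.2.1, hδ.2.2.2.2.2.1,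
      hδ.2.2.2.2.2.2 1⟩
  exact h D ρ Λ (m 1) a b Φ L Lb ψ hρ (hflat 1) hadm' hK ha hb hΦa hΦb hL hexpL hLb hψ hψc hψs

theorem hexObservableLimit_of_sourceFree' (h : SourceFreeObservableLimit) :
    Theses.SAWDevelopingMap.HexObservableLimit :=
  hexObservableLimit_iff.1 (hexObservableLimit_of_sourceFree h)

/-- The crux WEAKENED by the strengthened hypothesis (what a source-free line would prove first);
it does NOT give the crux back: the conclusion's target `b` is an arbitrary `IsEmbEndpointApprox`
endpoint, where no observable statement normalised AT `b` is available (`Negative.RootSilence`). -/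
def SourceFreeCrux : Prop :=
  SourceFreeObservableLimit → Theses.SAWSpinMonotone.HexTight →
    ∀ (D : DobrushinDomain) (a b : ℝ → HexVertex), IsEmbEndpointApprox hexGraph hexCenter D a b →
      ConvergesInLawToSLE ((8 : NNReal) / 3) D
        (fun δ (γ : HexDomainSAW D.carrier δ (a δ) (b δ)) => γ.curve)
        (fun δ => hexSAWLaw D.carrier δ (a δ) (b δ))

theorem sourceFreeCrux_of_crux (h : Theses.SAWSpinMonotone.ObservableToSLE) : SourceFreeCrux :=
  fun hS hT => h (hexObservableLimit_of_sourceFree hS) hT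

end Summit.CriticalPhenomena.SAWScalingLimit.Cruxes.ObservableToSLE.StrategistB1

end
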